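import Summits.CriticalPhenomena.PercolationContinuityZ3.Theorems.Transplant.FKConnectivityAllQK5DisjBlocks
import HarnessLib

/-!
# `K₅` is Potts–Rayleigh (`0 < q ≤ 1`), disjoint pairs — file 4: semantics of the fiber check, mask-level SLICE POSITIVITY

Helper file (`--supports stmt-CriticalPhenomena-4575`), FK sub-lane `prim-bschramm-fk-3` (gen 11) of the post-continuity programme;
builds on p205010 (kernel theorem, internal audit signed; external expert review pending).  No named facts, no sorries; standard axioms.

THE THEOREM OF THIS CHAIN (`…K5Disj`): **`K₅` is Potts–Rayleigh for every `0 < q ≤ 1`** — the random-cluster measure `φ_{w,q}` on every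
weighted graph with at most five vertices is edge-negatively associated, `φ(J_e ∩ J_f) ≤ φ(J_e)φ(J_f)` for ALL pairs `e ≠ f` (adjacent pairs:
gen 10, `…K5`; this chain: the disjoint pairs, one `S₅`-orbit, `(e, f) = (01, 23)`).  Wagner 2008, Ex. 5.2 records Sokal's computation for
`K₄`; for `K₅` the Rayleigh difference `Z¹⁰Z⁰¹ − Z⁰⁰Z¹¹` of `(01, 23)` has negative coefficients that no binomial (AM–GM) square repairs
(gen 10, LP scoping), so the certificate is a SUM OF GRAM SQUARES: with `y` the odds parameters of the eight pairs `E₈' = K₅ − {01, 23}`,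
the reduced difference `D̂ = (Z¹⁰Z⁰¹ − Z⁰⁰Z¹¹)/(q²(1−q))` (degree `4` in `q`) is written in the scaled Bernstein basis
`Σ_{j ≤ 4} B̃_j(y) q^j (1−q)^{4−j}`, and each slice `B̃_j` is certified `≥ 0` on the orthant as
`B̃_j = Σ_T y^T · m_Tᵀ H_{T,j} m_T + (nonnegative coefficients)`, `|T| ≤ 2`, `m_T` the multi-affine monomials off `T` inside the
Newton polytope, `H_{T,j} = U K Uᵀ` integer positive semidefinite (witness `s²K = LLᵀ + E`, `E` diagonally dominant).  The certificates
were found by semidefinite programming, facial reduction and integer rounding OUTSIDE Lean (bschramm/FK-BARRIER.md §15) and are CHECKED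
HERE BY THE KERNEL (`decide +kernel`), fiber by fiber (`3^8 = 6561` fibers per slice).
[cite: Wagner2006, Ex. 5.2, Conj. 5.3, Thm. 5.8 (p. 13)] [cite: Grimmett2006, §3.9 eq. (3.94), Conj. (3.96) (pp. 63–66); §1.4 eq. (1.20) (p. 15)]

THIS FILE: the coefficient bins of the checker are the fiber coefficients (`zAt_fiberBins`: `c_e(I,J) = Σ_{S ⊆ J∖I} pairCoef(I+S, J−S, e)`);
soundness of the fiber checker (`checkFibers_sound`: clean bins and `Σ_{key = (I,J)} H ≤ den·B̃_j(I,J)` on its range); the weighted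
contribution total of well-formed blocks is `Σ_T tW(T)·(quadratic form of H_T) ≥ 0`; regrouping it over fibers; and
**`slice_nonneg`**: blocks well-formed + all fibers certified ⇒ `Σ_{I ⊆ J} cW(I,J)·B̃_j(I,J) ≥ 0` on `[0,1]⁸`.  Also the package
`SliceCertified j` that the data files `…K5DisjCert*` establish by `decide`.
-/

noncomputable section

namespace Summit.CriticalPhenomena.PercolationContinuityZ3.Theorems

namespace FK

namespace K5D

open Finset

/-- `addAt` preserves the length. [folklore] -/
theorem length_addAt (l : List ℤ) (i : ℕ) (v : ℤ) : (addAt l i v).length = l.length := by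
  induction l generalizing i with
  | nil => simp [addAt]
  | cons x l ih => cases i <;> simp [addAt, ih]

/-- `addAt` adds `v` at position `i` and nothing elsewhere. [folklore] -/
theorem zAt_addAt (l : List ℤ) (i e : ℕ) (v : ℤ) (hi : i < l.length) :
    zAt (addAt l i v) e = zAt l e + if e = i then v else 0 := by
  induction l generalizing i e with
  | nil => simp at hi
  | cons x l ih =>
    cases i with
    | zero =>
      cases e with
      | zero => simp [addAt, zAt]
      | succ e => simp [addAt, zAt]
    | succ i =>
      cases e with
      | zero => simp [addAt, zAt]
      | succ e =>
        have hi' : i < l.length := by simpa using hi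
        have ih' := ih i e hi'
        unfold zAt at ih' ⊢
        simp only [addAt, List.getD_cons_succ]
        rw [ih']
        simp

/-- entries of a zero list are zero. [folklore] -/
theorem zAt_replicate (n e : ℕ) : zAt (List.replicate n (0 : ℤ)) e = 0 := by
  unfold zAt
  rw [List.getD_eq_getElem?_getD, List.getElem?_replicate]
  split_ifs <;> simp

/-- cluster counts of masks are at most `5` (decide). [folklore] -/
theorem kOf_le : ∀ m ∈ List.range 256, kOf m ≤ 5 := by
  have h : ((List.range 256).all fun m => decide (kOf m ≤ 5)) = true := by decide +kernel
  intro m hm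
  simpa using (List.all_eq_true.1 h) m hm

/-- `binStep` preserves the length. [folklore] -/
theorem length_binStep (I J : ℕ) (bins : List ℤ) (S : ℕ) : (binStep I J bins S).length = bins.length := by
  unfold binStep; rw [length_addAt, length_addAt]

/-- `bif (e == m)` as an `if`. [folklore] -/
theorem cond_beq_eq_ite (e m : ℕ) (x : ℤ) : (bif (e == m) then x else 0) = if e = m then x else 0 := by
  by_cases h : e = m
  · subst h; simp
  · rw [if_neg h, beq_false_of_ne h]; rfl

/-- one bin step adds the two pair coefficients. [folklore] -/
theorem zAt_binStep (I J S e : ℕ) (bins : List ℤ) (hlen : bins.length = 13) (h1 : I + S < 256) (h2 : J - S < 256) :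
    zAt (binStep I J bins S) e = zAt bins e + pairCoef (I + S) (J - S) e := by
  have k1 := kOf_le (I + S) (List.mem_range.2 h1)
  have k2 := kOf_le (J - S) (List.mem_range.2 h2)
  unfold binStep pairCoef
  rw [zAt_addAt _ _ _ _ (by rw [length_addAt, hlen]; omega), zAt_addAt _ _ _ _ (by rw [hlen]; omega),
    cond_beq_eq_ite, cond_beq_eq_ite]
  by_cases e1 : e = kOf (I + S) + kOf (J - S)
  · have e2 : ¬ e = kOf (I + S) + kOf (J - S) + 1 := by omega
    simp only [if_pos e1, if_neg e2]; ring
  · by_cases e2 : e = kOf (I + S) + kOf (J - S) + 1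
    · simp only [if_neg e1, if_pos e2]; ring
    · simp only [if_neg e1, if_neg e2]; ring

/-- the bin fold accumulates the pair coefficients. [folklore] -/
theorem zAt_foldl_binStep (I J e : ℕ) (l : List ℕ) (hl : ∀ S ∈ l, I + S < 256 ∧ J - S < 256) :
    ∀ init : List ℤ, init.length = 13 →
      zAt (l.foldl (binStep I J) init) e = zAt init e + (l.map fun S => pairCoef (I + S) (J - S) e).sum := by
  induction l with
  | nil => intro init _; simp
  | cons S l ih =>
    intro init hinit
    rw [List.foldl_cons, ih (fun S' hS' => hl S' (List.mem_cons_of_mem _ hS')) _ (by rw [length_binStep, hinit]),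
      zAt_binStep I J S e init hinit (hl S (List.mem_cons_self)).1 (hl S (List.mem_cons_self)).2]
    simp [add_assoc]

/-- **The bins are the fiber coefficients**: `c_e(I,J) = Σ_{S ⊆ J∖I} pairCoef (I+S) (J−S) e`. [folklore] -/
theorem zAt_fiberBins {I J : ℕ} (hI : I < 256) (hJ : J < 256) (hIJ : I &&& J = I) (e : ℕ) :
    zAt (fiberBins I J) e = ((submasks (J - I)).map fun S => pairCoef (I + S) (J - S) e).sum := by
  have hl : ∀ S ∈ submasks (J - I), I + S < 256 ∧ J - S < 256 := by
    intro S hS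
    have hf := fiber_facts J (List.mem_range.2 hJ) I (List.mem_range.2 hI) hIJ S hS
    constructor <;> omega
  unfold fiberBins
  rw [zAt_foldl_binStep I J e _ hl _ (by simp), zAt_replicate, zero_add]

/-- the contribution sum of the fiber `(I, J)` -/
def fsum (cert : List ℕ) (I J : ℕ) : ℤ := (((contribs cert).filter fun e => e.1 == I + 256 * J).map Prod.snd).sum

/-- `P − M` is the plain sum of the values -/
theorem pos_sub_neg_eq_sum (l : List (ℕ × ℤ)) :
    ((l.foldl (fun s e => s + zpos e.2) 0 : ℕ) : ℤ) - ((l.foldl (fun s e => s + zneg e.2) 0 : ℕ) : ℤ) = (l.map Prod.snd).sum := by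
  have hfold : ∀ (f : ℕ × ℤ → ℕ) (l : List (ℕ × ℤ)) (init : ℕ), l.foldl (fun s e => s + f e) init = init + (l.map f).sum := by
    intro f l
    induction l with
    | nil => intro init; simp
    | cons a l ih => intro init; rw [List.foldl_cons, ih]; simp [add_assoc]
  rw [hfold (fun e => zpos e.2) l 0, hfold (fun e => zneg e.2) l 0, zero_add, zero_add]
  induction l with
  | nil => simp
  | cons a l ih =>
    simp only [List.map_cons, List.sum_cons, Nat.cast_add]
    have ha : ((zpos a.2 : ℕ) : ℤ) - ((zneg a.2 : ℕ) : ℤ) = a.2 := by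
      unfold zpos zneg; exact Int.toNat_sub_toNat_neg a.2
    linarith

/-- **Soundness of the fiber checker** on its range. [folklore] -/
theorem checkFibers_sound {j den : ℕ} {cert : List ℕ} {Jlo len : ℕ} (h : checkFibers j den cert Jlo len = true)
    {J : ℕ} (hJ1 : Jlo ≤ J) (hJ2 : J < Jlo + len) {I : ℕ} (hI : I < 256) (hIJ : I &&& J = I) :
    binsClean (fiberBins I J) = true ∧ fsum cert I J ≤ (den : ℤ) * bern j (fiberBins I J) := by
  unfold checkFibers at h
  simp only [List.all_eq_true] at h
  have hJm : J ∈ List.range' Jlo len := List.mem_range'_1.2 ⟨hJ1, hJ2⟩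
  have hhi : I / 16 ∈ List.range 16 := List.mem_range.2 (by omega)
  have hlo : I % 16 ∈ List.range 16 := List.mem_range.2 (Nat.mod_lt _ (by norm_num))
  have h' := h J hJm (I / 16) hhi (I % 16) hlo
  have hI16 : 16 * (I / 16) + I % 16 = I := Nat.div_add_mod I 16
  rw [hI16] at h'
  have hbeq : (I &&& J == I) = true := beq_iff_eq.2 hIJ
  rw [hbeq] at h'
  simp only [Bool.not_true, Bool.false_or] at h'
  unfold fiberOK at h'
  rw [Bool.and_eq_true, decide_eq_true_eq] at h'
  refine ⟨h'.1, ?_⟩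
  have hsum := h'.2
  rw [pos_sub_neg_eq_sum] at hsum
  -- identify the filtered list
  rw [List.filter_filter, List.filter_filter, List.filter_filter] at hsum
  unfold fsum
  have hcongr : ((contribs cert).filter fun e =>
      ((e.1 &&& 255 == I) && ((e.1 &&& 255) >>> 4 == I / 16)) && (e.1 >>> 8 == J) &&
        (decide (Jlo ≤ e.1 >>> 8) && decide (e.1 >>> 8 < Jlo + len))) =
      (contribs cert).filter fun e => e.1 == I + 256 * J := by
    refine List.filter_congr fun e _ => ?_
    rw [show e.1 &&& 255 = e.1 % 256 from Nat.and_two_pow_sub_one_eq_mod e.1 8,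
      show e.1 >>> 8 = e.1 / 256 from Nat.shiftRight_eq_div_pow e.1 8,
      show (e.1 % 256) >>> 4 = e.1 % 256 / 16 from Nat.shiftRight_eq_div_pow _ 4]
    by_cases he : e.1 = I + 256 * J
    · have h1 : e.1 % 256 = I := by omega
      have h2 : e.1 / 256 = J := by omega
      have hr : (e.1 == I + 256 * J) = true := beq_iff_eq.2 he
      rw [hr, h1, h2]
      simp [hJ1, hJ2]
    · have : ¬ (e.1 % 256 = I ∧ e.1 / 256 = J) := by
        intro ⟨h1, h2⟩; exact he (by omega)
      rw [show (e.1 == I + 256 * J) = false from beq_false_of_ne he]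
      rw [Bool.eq_false_iff]
      intro hc
      simp only [Bool.and_eq_true, beq_iff_eq, decide_eq_true_eq] at hc
      exact this ⟨hc.1.1.1, hc.1.2⟩
  rw [hcongr] at hsum
  exact hsum

variable (u : Fin 8 → ℝ)

/-- the `T`-part weight `Π_{i ∈ T} u_i (1 − u_i)` -/
noncomputable def tW (T : ℕ) : ℝ := ∏ i : Fin 8, if T.testBit i then u i * (1 - u i) else 1
/-- the reduced configuration weight off `T` -/
noncomputable def vT (T β : ℕ) : ℝ := ∏ i : Fin 8, if T.testBit i then 1 else if β.testBit i then u i else 1 - u i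

/-- `tW ≥ 0` on `[0,1]⁸`. [folklore] -/
theorem tW_nonneg (h0 : ∀ i, 0 ≤ u i) (h1 : ∀ i, u i ≤ 1) (T : ℕ) : 0 ≤ tW u T := by
  unfold tW
  refine Finset.prod_nonneg fun i _ => ?_
  have := h0 i; have := h1 i
  split_ifs
  · exact mul_nonneg (h0 i) (by linarith)
  · exact zero_le_one

/-- fiber constant of a block contribution: `cW(βa ∧ βb, T ∨ βa ∨ βb) = tW(T) · vT(βa) · vT(βb)` for `βa, βb` disjoint from `T` -/
theorem cW_block (T βa βb : ℕ) (ha : βa &&& T = 0) (hb : βb &&& T = 0) :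
    cW u (βa &&& βb) (T ||| βa ||| βb) = tW u T * (vT u T βa * vT u T βb) := by
  unfold cW tW vT
  rw [← Finset.prod_mul_distrib, ← Finset.prod_mul_distrib]
  refine Finset.prod_congr rfl fun i _ => ?_
  have ha' : (βa &&& T).testBit i = false := by rw [ha]; exact Nat.zero_testBit i
  have hb' : (βb &&& T).testBit i = false := by rw [hb]; exact Nat.zero_testBit i
  rw [Nat.testBit_land] at ha' hb'
  rw [Nat.testBit_land, Nat.testBit_lor, Nat.testBit_lor]
  cases hT : T.testBit i <;> cases hA : βa.testBit i <;> cases hB : βb.testBit i <;> simp_all [mul_comm]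

/-- the weighted sum of the contributions of one block is the block quadratic form at `vT` times `tW` -/
theorem blockContribs_weighted_sum {c : ℕ} (h : blockOK c = true) :
    ((blockContribs c).map fun e => cW u (e.1 % 256) (e.1 / 256) * (e.2 : ℝ)).sum =
      tW u (hT c) * ∑ a ∈ range (hn c), ∑ b ∈ range (hn c), (eH c a b : ℝ) * (vT u (hT c) (bas c a) * vT u (hT c) (bas c b)) := by
  obtain ⟨_, _, _, _, hdisj, _, _, _⟩ := blockOK_sound h
  unfold blockContribs
  have hsf : ∀ (l : List ℕ) (f : ℕ → List ℝ), (l.flatMap f).sum = (l.map fun a => (f a).sum).sum := by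
    intro l f
    induction l with
    | nil => simp
    | cons a l ih => rw [List.flatMap_cons, List.sum_append, ih, List.map_cons, List.sum_cons]
  have hlr : ∀ (n : ℕ) (f : ℕ → ℝ), ((List.range n).map f).sum = ∑ a ∈ range n, f a := by
    intro n f
    induction n with
    | zero => simp
    | succ n ih => rw [List.range_succ, List.map_append, List.sum_append, ih, Finset.sum_range_succ]; simp
  rw [List.map_flatMap, hsf, hlr, Finset.mul_sum]
  refine Finset.sum_congr rfl fun a ha => ?_
  rw [List.map_map, hlr, Finset.mul_sum]
  refine Finset.sum_congr rfl fun b hb => ?_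
  have hab : (bas c a &&& bas c b) < 256 := lt_of_le_of_lt Nat.and_le_left (bas_lt c a)
  have h1 : ((bas c a &&& bas c b) + 256 * (hT c ||| bas c a ||| bas c b)) % 256 = bas c a &&& bas c b := by omega
  have h2 : ((bas c a &&& bas c b) + 256 * (hT c ||| bas c a ||| bas c b)) / 256 = (hT c ||| bas c a ||| bas c b) := by omega
  simp only [Function.comp]
  rw [h1, h2, cW_block u _ _ _ (hdisj a (mem_range.1 ha)) (hdisj b (mem_range.1 hb))]
  ring

/-- the weighted contribution total of a certificate with well-formed blocks is nonnegative -/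
theorem contribs_weighted_sum_nonneg (h0 : ∀ i, 0 ≤ u i) (h1 : ∀ i, u i ≤ 1) {cert : List ℕ}
    (hblocks : ∀ c ∈ cert, blockOK c = true) :
    0 ≤ ((contribs cert).map fun e => cW u (e.1 % 256) (e.1 / 256) * (e.2 : ℝ)).sum := by
  unfold contribs
  have hsf : ∀ (l : List ℕ) (f : ℕ → List ℝ), (l.flatMap f).sum = (l.map fun a => (f a).sum).sum := by
    intro l f
    induction l with
    | nil => simp
    | cons a l ih => rw [List.flatMap_cons, List.sum_append, ih, List.map_cons, List.sum_cons]
  rw [List.map_flatMap, hsf]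
  refine List.sum_nonneg ?_
  intro x hx
  rw [List.mem_map] at hx
  obtain ⟨c, hc, rfl⟩ := hx
  rw [blockContribs_weighted_sum u (hblocks c hc)]
  exact mul_nonneg (tW_nonneg u h0 h1 _) (block_quadForm_nonneg (hblocks c hc) _)

/-- keys of contributions are valid fibers -/
theorem key_valid {cert : List ℕ} {e : ℕ × ℤ} (he : e ∈ contribs cert) :
    e.1 % 256 < 256 ∧ e.1 / 256 < 256 ∧ (e.1 % 256) &&& (e.1 / 256) = e.1 % 256 := by
  unfold contribs at he
  rw [List.mem_flatMap] at he
  obtain ⟨c, _, he⟩ := he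
  unfold blockContribs at he
  rw [List.mem_flatMap] at he
  obtain ⟨a, _, he⟩ := he
  rw [List.mem_map] at he
  obtain ⟨b, _, rfl⟩ := he
  dsimp only
  have hab : (bas c a &&& bas c b) < 256 := lt_of_le_of_lt Nat.and_le_left (bas_lt c a)
  have hTl := hT_lt c
  have hJ : (hT c ||| bas c a ||| bas c b) < 256 :=
    Nat.or_lt_two_pow (n := 8) (Nat.or_lt_two_pow (n := 8) hTl (bas_lt c a)) (bas_lt c b)
  have h1 : ((bas c a &&& bas c b) + 256 * (hT c ||| bas c a ||| bas c b)) % 256 = bas c a &&& bas c b := by omega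
  have h2 : ((bas c a &&& bas c b) + 256 * (hT c ||| bas c a ||| bas c b)) / 256 = (hT c ||| bas c a ||| bas c b) := by omega
  rw [h1, h2]
  refine ⟨hab, hJ, Nat.eq_of_testBit_eq fun i => ?_⟩
  rw [Nat.testBit_land, Nat.testBit_land, Nat.testBit_lor, Nat.testBit_lor]
  cases (bas c a).testBit i <;> cases (bas c b).testBit i <;> simp

/-- regrouping the weighted contribution total over fibers -/
theorem fiber_regroup (l : List (ℕ × ℤ))
    (hl : ∀ e ∈ l, e.1 % 256 < 256 ∧ e.1 / 256 < 256 ∧ (e.1 % 256) &&& (e.1 / 256) = e.1 % 256) :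
    ∑ J ∈ range 256, ∑ I ∈ range 256,
      (if I &&& J = I then cW u I J * ((((l.filter fun e => e.1 == I + 256 * J).map Prod.snd).sum : ℤ) : ℝ) else 0) =
      (l.map fun e => cW u (e.1 % 256) (e.1 / 256) * (e.2 : ℝ)).sum := by
  induction l with
  | nil => simp
  | cons e l ih =>
    have hel := hl e (List.mem_cons_self)
    have ih' := ih fun e' he' => hl e' (List.mem_cons_of_mem _ he')
    rw [List.map_cons, List.sum_cons, ← ih']
    -- split the head off every fiber sum
    have hsplit : ∀ J ∈ range 256, ∀ I ∈ range 256,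
        (if I &&& J = I then cW u I J * (((((e :: l).filter fun e' => e'.1 == I + 256 * J).map Prod.snd).sum : ℤ) : ℝ) else 0) =
        (if I &&& J = I then cW u I J * (if e.1 = I + 256 * J then (e.2 : ℝ) else 0) else 0) +
          (if I &&& J = I then cW u I J * ((((l.filter fun e' => e'.1 == I + 256 * J).map Prod.snd).sum : ℤ) : ℝ) else 0) := by
      intro J _ I _
      by_cases hIJ : I &&& J = I
      · simp only [if_pos hIJ, List.filter_cons]
        by_cases hk : e.1 = I + 256 * J
        · simp [hk, mul_add]
        · simp [hk]
      · simp [hIJ]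
    rw [Finset.sum_congr rfl fun J hJ => Finset.sum_congr rfl fun I hI => hsplit J hJ I hI]
    simp only [Finset.sum_add_distrib]
    congr 1
    -- the head contributes exactly at `(I, J) = (e.1 % 256, e.1 / 256)`
    rw [Finset.sum_eq_single (e.1 / 256)]
    · rw [Finset.sum_eq_single (e.1 % 256)]
      · rw [if_pos hel.2.2, if_pos (by omega)]
      · intro I _ hI
        by_cases h : I &&& e.1 / 256 = I
        · rw [if_pos h, if_neg (by omega), mul_zero]
        · rw [if_neg h]
      · intro h; exact absurd (mem_range.2 hel.1) h
    · intro J _ hJ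
      refine Finset.sum_eq_zero fun I hI => ?_
      by_cases h : I &&& J = I
      · rw [if_pos h, if_neg (by have := mem_range.1 hI; omega), mul_zero]
      · rw [if_neg h]
    · intro h; exact absurd (mem_range.2 hel.2.1) h

/-- **Mask-level slice positivity**: well-formed blocks + all fibers certified ⇒
`Σ_{I ⊆ J} c(I,J) · B̃_j(I,J) ≥ 0` for every parameter vector in `[0,1]⁸`. [folklore] -/
theorem slice_nonneg (h0 : ∀ i, 0 ≤ u i) (h1 : ∀ i, u i ≤ 1) {j den : ℕ} {cert : List ℕ} (hden : 0 < den)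
    (hblocks : ∀ c ∈ cert, blockOK c = true)
    (hfib : ∀ J < 256, ∀ I < 256, I &&& J = I → fsum cert I J ≤ (den : ℤ) * bern j (fiberBins I J)) :
    0 ≤ ∑ J ∈ range 256, ∑ I ∈ range 256, if I &&& J = I then cW u I J * (bern j (fiberBins I J) : ℝ) else 0 := by
  have hdenR : (0 : ℝ) < den := by exact_mod_cast hden
  have hle : ((contribs cert).map fun e => cW u (e.1 % 256) (e.1 / 256) * (e.2 : ℝ)).sum ≤
      (den : ℝ) * ∑ J ∈ range 256, ∑ I ∈ range 256, if I &&& J = I then cW u I J * (bern j (fiberBins I J) : ℝ) else 0 := by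
    rw [← fiber_regroup u (contribs cert) fun e he => key_valid he, Finset.mul_sum]
    refine Finset.sum_le_sum fun J hJ => ?_
    rw [Finset.mul_sum]
    refine Finset.sum_le_sum fun I hI => ?_
    by_cases hIJ : I &&& J = I
    · rw [if_pos hIJ, if_pos hIJ]
      have hc := cW_nonneg u h0 h1 I J
      have hf := hfib J (mem_range.1 hJ) I (mem_range.1 hI) hIJ
      have hf' : ((fsum cert I J : ℤ) : ℝ) ≤ (den : ℝ) * (bern j (fiberBins I J) : ℝ) := by exact_mod_cast hf
      unfold fsum at hf'
      nlinarith
    · rw [if_neg hIJ, if_neg hIJ, mul_zero]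
  have hnn := contribs_weighted_sum_nonneg u h0 h1 hblocks
  nlinarith

/-- **Slice `j` is certified**: some block data passes all structural checks and all fiber checks of slice `j`. -/
def SliceCertified (j : ℕ) : Prop :=
  ∃ den : ℕ, ∃ cert : List ℕ, 0 < den ∧ (∀ c ∈ cert, blockOK c = true) ∧
    ∀ J < 256, ∀ I < 256, I &&& J = I → binsClean (fiberBins I J) = true ∧ fsum cert I J ≤ (den : ℤ) * bern j (fiberBins I J)

/-- packaging eight fiber shards of width `32` and the block checks into `SliceCertified` -/
theorem sliceCertified_of_shards {j den : ℕ} {cert : List ℕ} (hden : 0 < den) (hb : cert.all blockOK = true)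
    (h : ∀ k < 8, checkFibers j den cert (32 * k) 32 = true) : SliceCertified j := by
  refine ⟨den, cert, hden, fun c hc => (List.all_eq_true.1 hb) c hc, fun J hJ I hI hIJ => ?_⟩
  have hk : J / 32 < 8 := by omega
  exact checkFibers_sound (h (J / 32) hk) (by omega) (by omega) hI hIJ

/-- three consecutive shards of a list cover it (`take 13`, `drop 13 · take 12`, `drop 13 · drop 12`). [folklore] -/
theorem all_of_three {p : ℕ → Bool} {l : List ℕ} (h1 : (l.take 13).all p = true) (h2 : ((l.drop 13).take 12).all p = true)
    (h3 : ((l.drop 13).drop 12).all p = true) : l.all p = true := by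
  rw [← List.take_append_drop 13 l, List.all_append, h1, Bool.true_and, ← List.take_append_drop 12 (l.drop 13), List.all_append,
    h2, h3, Bool.true_and]

end K5D

end FK

end Summit.CriticalPhenomena.PercolationContinuityZ3.Theorems

end
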